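import Mathlib
import Summits.MatrixMultiplication.MatrixMultiplication.Theorems.SubgroupIdentityDesigns.Negative.TensorRankBridge
import Summits.MatrixMultiplication.MatrixMultiplication.Theorems.SubgroupIdentityDesigns.Negative.FrameGhost
import Summits.MatrixMultiplication.MatrixMultiplication.Theorems.SubgroupIdentityDesigns.Negative.ConstituentLevel
import Summits.MatrixMultiplication.MatrixMultiplication.Theorems.SubgroupIdentityDesigns.Negative.TopLevel

/-!
# The crux's level filtration IS the Gurevich–Howe tensor-rank filtration
# (support file for stmt-MatrixMultiplication-14079; cell B2b-5 `b2b-lgcu-borel`, gen 12 —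
# report `run/shared/lean/b2b/levelgraded-cu/ORACLE-g12.md` §G12-2)

Notation as in `TensorRankBridge`: `G = GL_m(𝔽_p)`, `F_k|_G = levelSet p m k`, `ω^{⊗k}` the
permutation representation on `m × k` matrices (character `GLn.tensorPermChar`),
`\widehat{GL}_m(ω^{⊗≤k}) = GLn.tensorSpectrumLE (ZMod p) m k`.  `TensorRankBridge` proved the hard
inclusion `Irr(G) ∩ F_k ⊆ \widehat{GL}_m(ω^{⊗≤k})` (`1 ≤ k ≤ m`).  This file adds the easy one and
closes the identification, for EVERY level `k`:

* `isCharacter_tensorPermChar` — `ω^{⊗l}` is a genuine representation (functions on `m × l`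
  matrices, `(g·f)(M) = f(g⁻¹M)`; trace of a permutation = number of fixed points, `trace_funLeft`);
* `tensorPermChar_mem_levelSet` — its character `g ↦ Σ_M [g M = M]` is a sum of transport
  indicators, hence a level-`l` function (`FrameGhost.transport_mem`);
* `tensorSpectrumLE_subset` — **`\widehat{GL}_m(ω^{⊗≤k}) ⊆ Irr(G) ∩ F_k`** (all `k`): irreducible
  constituents of a level-`k` character have level `k` (`ConstituentLevel.irrConstituent_mem_levelSet`);
* `irrChars_inter_levelSet_eq_tensorSpectrumLE` — **`Irr(GL_m(𝔽_p)) ∩ F_k = \widehat{GL}_m(ω^{⊗≤k})`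
  for every `k`** (level `0`: only the trivial character is constant; `k ≥ m`: both sides are all of
  `Irr`, `TopLevel`);
* `ncard_irr_level_eq_sum_card_conjClasses` — hence, conditionally on the vendored Gurevich–Howe
  count, the EXACT COUNT **`#(Irr(GL_m(𝔽_p)) ∩ F_k) = Σ_{j ≤ k} #Cl(GL_j(𝔽_p))`** for `2k ≤ m`
  (so `N_1 = 1 + (p − 1) = p` for `m ≥ 2` and `N_2 = p + #Cl(GL_2(𝔽_p)) = p² + p − 1` for `m ≥ 4`),
  replacing the one-sided bounds of `LevelCount` / `TensorRankBridge`.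

VALUE = theorem (the budget set of the crux identified with a classical object), NOT summit
progress; the crux item stays open.
-/

set_option linter.dupNamespace false

noncomputable section

open scoped BigOperators Matrix
open Module Literature.RepresentationTheory.FiniteGroups

namespace Summit.MatrixMultiplication.MatrixMultiplication.Theorems.SubgroupIdentityDesigns.Negative
namespace TensorRankDuality

open Summit.MatrixMultiplication.MatrixMultiplication.Theorems.LieRankDesigns.Negative
  (GLm Mat levelSet budget fourierFn RankSupp eq_trivial_of_const character_trivial_apply
    fourierFn_const_of_rankSupp_zero)
open Summit.MatrixMultiplication.MatrixMultiplication.Theorems.LevelOneGL2Designs.Negative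
  (levelSubmodule mem_levelSubmodule_iff)

variable {p : ℕ} [hp : Fact p.Prime] {m : ℕ}

/-! ## Permutation representations: trace = number of fixed points -/

/-- The trace of `f ↦ f ∘ φ` on functions on a finite type is the number of fixed points of `φ`.
[folklore] -/
theorem trace_funLeft {X : Type} [Fintype X] [DecidableEq X] (φ : X → X) :
    LinearMap.trace ℂ (X → ℂ) (LinearMap.funLeft ℂ ℂ φ) =
      ((Finset.univ.filter fun x => φ x = x).card : ℂ) := by
  rw [LinearMap.trace_eq_matrix_trace ℂ (Pi.basisFun ℂ X), Finset.natCast_card_filter]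
  show ∑ x, (LinearMap.toMatrix (Pi.basisFun ℂ X) (Pi.basisFun ℂ X)
      (LinearMap.funLeft ℂ ℂ φ)) x x = _
  refine Finset.sum_congr rfl fun x _ => ?_
  rw [LinearMap.toMatrix_apply, Pi.basisFun_repr, LinearMap.funLeft_apply, Pi.basisFun_apply]
  by_cases h : φ x = x
  · rw [if_pos h, h, Pi.single_eq_same]
  · rw [if_neg h, Pi.single_eq_of_ne h]

/-- `g⁻¹ M = M ↔ g M = M`. [folklore] -/
theorem inv_mul_eq_iff {l : ℕ} (g : GLm p m) (M : Matrix (Fin m) (Fin l) (ZMod p)) :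
    ((g⁻¹ : GLm p m) : Mat p m) * M = M ↔ (g : Mat p m) * M = M := by
  constructor
  · intro h
    calc (g : Mat p m) * M = (g : Mat p m) * (((g⁻¹ : GLm p m) : Mat p m) * M) := by rw [h]
      _ = M := by rw [← Matrix.mul_assoc, Units.mul_inv, Matrix.one_mul]
  · intro h
    calc ((g⁻¹ : GLm p m) : Mat p m) * M = ((g⁻¹ : GLm p m) : Mat p m) * ((g : Mat p m) * M) := by
          rw [h]
      _ = M := by rw [← Matrix.mul_assoc, Units.inv_mul, Matrix.one_mul]

/-- `ω^{⊗l}(g) = Σ_M [g M = M]`. [folklore] -/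
theorem tensorPermChar_eq_sum {l : ℕ} (g : GLm p m) :
    GLn.tensorPermChar (ZMod p) m l g =
      ∑ M : Matrix (Fin m) (Fin l) (ZMod p), if (g : Mat p m) * M = M then (1 : ℂ) else 0 := by
  unfold GLn.tensorPermChar
  rw [Finset.natCast_card_filter]
  refine Finset.sum_congr rfl fun M _ => ?_
  by_cases h : (g : Mat p m) * M = M
  · rw [if_pos h, if_pos h]
  · rw [if_neg h, if_neg h]

/-- **`ω^{⊗l}` is a character**: the permutation representation of `GL_m(𝔽_p)` on functions on
`m × l` matrices, `(g · f)(M) = f(g⁻¹ M)`, has character `g ↦ #{M : g M = M} = GLn.tensorPermChar`.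
[cite: GurevichHowe2021, §2.2] -/
theorem isCharacter_tensorPermChar (l : ℕ) :
    IsCharacter (GLm p m) (GLn.tensorPermChar (ZMod p) m l) := by
  classical
  obtain ⟨φ, hφ⟩ : ∃ φ : GLm p m → Matrix (Fin m) (Fin l) (ZMod p) → Matrix (Fin m) (Fin l) (ZMod p),
      ∀ g M, φ g M = ((g⁻¹ : GLm p m) : Mat p m) * M := ⟨_, fun _ _ => rfl⟩
  have hφ1 : φ 1 = id := by
    funext M
    rw [hφ, inv_one, Units.val_one, Matrix.one_mul, id]
  have hφmul : ∀ g h : GLm p m, φ (g * h) = φ h ∘ φ g := by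
    intro g h
    funext M
    rw [Function.comp_apply, hφ, hφ, hφ, mul_inv_rev, Units.val_mul, Matrix.mul_assoc]
  let ρ : Representation ℂ (GLm p m) (Matrix (Fin m) (Fin l) (ZMod p) → ℂ) :=
    { toFun := fun g => LinearMap.funLeft ℂ ℂ (φ g)
      map_one' := by
        apply LinearMap.ext
        intro f
        show LinearMap.funLeft ℂ ℂ (φ 1) f = f
        rw [hφ1]
        rfl
      map_mul' := fun g h => by
        show LinearMap.funLeft ℂ ℂ (φ (g * h)) =
          (LinearMap.funLeft ℂ ℂ (φ g)).comp (LinearMap.funLeft ℂ ℂ (φ h))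
        rw [hφmul, LinearMap.funLeft_comp] }
  refine ⟨Matrix (Fin m) (Fin l) (ZMod p) → ℂ, inferInstance, inferInstance, inferInstance, ρ,
    funext fun g => ?_⟩
  show LinearMap.trace ℂ _ (LinearMap.funLeft ℂ ℂ (φ g)) = GLn.tensorPermChar (ZMod p) m l g
  rw [trace_funLeft, tensorPermChar_eq_sum, Finset.natCast_card_filter]
  refine Finset.sum_congr rfl fun M _ => ?_
  rw [hφ]
  by_cases hM : (g : Mat p m) * M = M
  · rw [if_pos hM, if_pos ((inv_mul_eq_iff g M).mpr hM)]
  · rw [if_neg hM, if_neg (fun h' => hM ((inv_mul_eq_iff g M).mp h'))]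

/-! ## `ω^{⊗l}` has level `l` -/

/-- **`ω^{⊗l} ∈ F_l`**: the permutation character is a sum of transport indicators `[g M = M]`,
each a level-`l` function (`FrameGhost.transport_mem`). -/
theorem tensorPermChar_mem_levelSet (l : ℕ) :
    GLn.tensorPermChar (ZMod p) m l ∈ levelSet p m l := by
  classical
  have h : GLn.tensorPermChar (ZMod p) m l = ∑ M : Matrix (Fin m) (Fin l) (ZMod p),
      fun g : GLm p m => if (g : Mat p m) * M = M then (1 : ℂ) else 0 := by
    funext g
    rw [Finset.sum_apply]
    exact tensorPermChar_eq_sum g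
  have hmem : GLn.tensorPermChar (ZMod p) m l ∈ levelSubmodule p m l := by
    rw [h]
    exact Submodule.sum_mem _ fun M _ => FrameGhost.transport_mem M M
  exact mem_levelSubmodule_iff.mp hmem

/-- The levels are nested: `F_l ⊆ F_k` for `l ≤ k`. [folklore] -/
theorem levelSet_mono {l k : ℕ} (hlk : l ≤ k) : levelSet p m l ⊆ levelSet p m k := by
  rintro f ⟨c, hc, hf⟩
  exact ⟨c, fun M hM => hc M (lt_of_le_of_lt hlk hM), hf⟩

/-- The cumulative spectra are nested. [folklore] -/
theorem tensorSpectrumLE_mono {l k : ℕ} (hlk : l ≤ k) :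
    GLn.tensorSpectrumLE (ZMod p) m l ⊆ GLn.tensorSpectrumLE (ZMod p) m k := by
  rintro χ ⟨j, hj, hχ⟩
  exact ⟨j, hj.trans hlk, hχ⟩

/-! ## The easy inclusion and the identification -/

/-- **`\widehat{GL}_m(ω^{⊗≤k}) ⊆ Irr(GL_m(𝔽_p)) ∩ F_k`** (every `k`): an irreducible constituent of the
level-`l` character `ω^{⊗l}`, `l ≤ k`, has level `l ≤ k`. -/
theorem tensorSpectrumLE_subset (k : ℕ) :
    GLn.tensorSpectrumLE (ZMod p) m k ⊆ irrChars (GLm p m) ∩ levelSet p m k := by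
  classical
  rintro χ ⟨l, hlk, hirr, hne⟩
  refine ⟨hirr, levelSet_mono hlk ?_⟩
  have hne' : classInner χ (GLn.tensorPermChar (ZMod p) m l) ≠ 0 := fun h0 =>
    hne ((TensorRankBridge.classInner_inst_irrel _ _ χ _).trans h0)
  exact ConstituentLevel.irrConstituent_mem_levelSet (isCharacter_tensorPermChar l)
    (tensorPermChar_mem_levelSet l) hirr hne'

/-- Level `0`: an irreducible constant is the trivial character, which occurs in `ω^{⊗0} = 1`. -/
theorem subset_tensorSpectrumLE_zero :
    irrChars (GLm p m) ∩ levelSet p m 0 ⊆ GLn.tensorSpectrumLE (ZMod p) m 0 := by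
  classical
  rintro χ ⟨hirr, c, hc, hfc⟩
  have hχ : χ = (Representation.trivial ℂ (GLm p m) ℂ).character :=
    eq_trivial_of_const hirr (K := c 0) fun g => by rw [hfc, fourierFn_const_of_rankSupp_zero hc]
  simp only [GLn.tensorSpectrumLE, GLn.tensorSpectrum, Set.mem_setOf_eq]
  refine ⟨0, le_rfl, hirr, fun h0 => ?_⟩
  have h0' : classInner χ (GLn.tensorPermChar (ZMod p) m 0) = 0 :=
    (TensorRankBridge.classInner_inst_irrel _ _ χ _).trans h0
  rw [classInner_apply, hχ] at h0'
  simp only [GLn.tensorPermChar_zero, character_trivial_apply, mul_one, Finset.sum_const,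
    Finset.card_univ, nsmul_eq_mul] at h0'
  exact one_ne_zero ((inv_mul_cancel₀ (Nat.cast_ne_zero.mpr
    (Fintype.card_ne_zero (α := GLm p m)))).symm.trans h0')

/-- The hard inclusion at every level `k ≤ m` (`TensorRankBridge` for `k ≥ 1`, the above for `k = 0`). -/
theorem subset_tensorSpectrumLE {k : ℕ} (hkm : k ≤ m) :
    irrChars (GLm p m) ∩ levelSet p m k ⊆ GLn.tensorSpectrumLE (ZMod p) m k := by
  rcases Nat.eq_zero_or_pos k with rfl | hk
  · exact subset_tensorSpectrumLE_zero
  · exact TensorRankBridge.irrChars_inter_levelSet_subset_tensorSpectrumLE hk hkm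

/-- **THE IDENTIFICATION.**  For every prime `p` and all `m, k`:
`Irr(GL_m(𝔽_p)) ∩ F_k = \widehat{GL}_m(ω^{⊗≤k})` — the budget set of the crux `SubgroupIdentityDesigns`
at level `k` is exactly the set of irreducible characters of Gurevich–Howe tensor rank `≤ k`. -/
theorem irrChars_inter_levelSet_eq_tensorSpectrumLE (k : ℕ) :
    irrChars (GLm p m) ∩ levelSet p m k = GLn.tensorSpectrumLE (ZMod p) m k := by
  refine Set.Subset.antisymm ?_ (tensorSpectrumLE_subset k)
  rcases le_or_gt k m with hkm | hmk
  · exact subset_tensorSpectrumLE hkm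
  · intro χ hχ
    have hm : χ ∈ irrChars (GLm p m) ∩ levelSet p m m := ⟨hχ.1, exists_level_of_le le_rfl χ⟩
    exact tensorSpectrumLE_mono hmk.le (subset_tensorSpectrumLE le_rfl hm)

/-- **EXACT COUNT** (conditional on the vendored Gurevich–Howe eta-correspondence count): for
`2k ≤ m`, `#(Irr(GL_m(𝔽_p)) ∩ F_k) = Σ_{j ≤ k} #Cl(GL_j(𝔽_p))`. -/
theorem ncard_irr_level_eq_sum_card_conjClasses (hGH : GurevichHowe2021_etaCorrespondence_card)
    {k : ℕ} (h2k : 2 * k ≤ m) :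
    (irrChars (GLm p m) ∩ levelSet p m k).ncard =
      ∑ j ∈ Finset.range (k + 1),
        Nat.card (ConjClasses (Matrix.GeneralLinearGroup (Fin j) (ZMod p))) := by
  rw [irrChars_inter_levelSet_eq_tensorSpectrumLE, hGH.cumulative_eq_sum_card_conjClasses (ZMod p) h2k]

/-- The budget set is monotone in the level and saturates at `k = m`:
`Irr ∩ F_k = \widehat{GL}_m(ω^{⊗≤min(k,m)})`. -/
theorem irrChars_inter_levelSet_eq_min (k : ℕ) :
    irrChars (GLm p m) ∩ levelSet p m k = GLn.tensorSpectrumLE (ZMod p) m (min k m) := by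
  rw [irrChars_inter_levelSet_eq_tensorSpectrumLE]
  rcases le_or_gt k m with hkm | hmk
  · rw [min_eq_left hkm]
  · rw [min_eq_right hmk.le]
    refine Set.Subset.antisymm ?_ (tensorSpectrumLE_mono hmk.le)
    intro χ hχ
    have hm : χ ∈ irrChars (GLm p m) ∩ levelSet p m m :=
      ⟨GLn.tensorSpectrumLE_subset_irrChars k hχ, exists_level_of_le le_rfl χ⟩
    exact subset_tensorSpectrumLE le_rfl hm

end TensorRankDuality
end Summit.MatrixMultiplication.MatrixMultiplication.Theorems.SubgroupIdentityDesigns.Negative
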